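import Summits.QuantumFields.YangMills.Theorems.FiniteRankMirrorDefectPeelingPrep
import Summits.QuantumFields.YangMills.Theorems.FiniteRankMirrorPeeling
import HarnessLib

/-!
# Route `FiniteRankMirror`, glue item `DefectPeelingGlue` (stmt-QuantumFields-23849): the two-sided chirality-defect
# bound from the ONE-POINT response law, by Markov peeling

Closing file (`--workitem stmt-QuantumFields-23849`; fleet lead prover of crux `NT`, unit `ym-spine-19353-p1`, g22) of
LINE g9-1b «Markov peeling» (ideator ym-idea-8 g9): `FemtoResponseLaw → MirrorPeeling → MirrorDefectVanishes`, an item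
SHARED by the routes `FiniteRankMirror` and `StaticSourceWitness` (both rung R2a → `BalabanLadder.NT`).

Proof.  The bare mirror floor that pins the unit in `MirrorDefectVanishes` is the `J = 1` menu of `FemtoResponseMoments`
(`FemtoResponseLaw` is its by-name alias), which yields the singleton response-moment law (RM₁) with data
`p, C₁, B, β₁, ℓ₁` at the unit `a` itself.  Take `ℓ₃ := ℓ₁/8`.  For `v` supported in `{y₀ > 0} ∩ B(0, ℓ₃)` (compact, time
floor `δ`), `FiniteRankMirrorDefectPeelingPrep.exists_posTimeCubeFamily` gives positive-time femto cubes `Q_β` carrying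
`v(aβ·)`.  On each large torus:
* §3 `defect_eq_mirrorCov`: `Q2(θv, v) − MF_box(v) = Cov_T((Wᴿ − Ṽ)∘Θ₀, Ṽ)` (`MarkovMirror.Q2_thetaTest_eq_torusCov_reflSmear`
  + reflection invariance `ConjugateResponse.torusE_comp_cfgReflect`); `abs_defect_le_peel`:
  `|defect| ≤ 2‖kerE_Q(Wᴿ) − kerE_Q(Ṽ) − p₁‖₂‖kerE_Q(Ṽ) − p₂‖₂` (`FiniteRankMirrorPeeling.mirror_peel`; no reflection
  positivity);
* §4 first factor `≤ √η₁` eventually (`MarkovMirror.rblΔ_l2_eventually_of_responseMoments`, the summation-by-parts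
  response bound paying one power of `aβ`), second factor `≤ K_V` uniformly (`smear_l2_le_of_responseMoments` =
  `MarkovMirror.typicalLaw_of_responseMoments` ⊕ `smear_response_sq_le_uniform`: the `aβ⁻⁴` support sites are paid by
  the `(aβ/κ)⁴` response), `η₁ := (η/(2K_V + 2))²`.

HONEST FRAMING: DLR/Markov bookkeeping on Wilson's finite-torus measure, CONDITIONAL on the open engine item
`FemtoResponseMoments` (spine-owed (RM₁), E0′-K class); nothing of (RM), NT or the mass gap is proved here; no summit is
proved by this line; not Clay.
-/

set_option autoImplicit false

noncomputable section

open scoped SchwartzMap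
open MeasureTheory Filter Topology
open Literature.MathematicalPhysics.QuantumFieldTheory Literature.MathematicalPhysics.QuantumLattice
open Literature.Probability.LatticeModels
open Summit.QuantumFields.YangMills.Cruxes.OSLegsFromFemtoAndGap.DlrCollarTransfer
open Summit.QuantumFields.YangMills.Cruxes.OSLegsFromFemtoAndGap.DlrCollarTransfer.StubLower (mem_cubeSites_iff)
open Summit.QuantumFields.YangMills.Cruxes.UVSeamRec.UnitTransfer (exists_radius)

namespace Summit.QuantumFields.YangMills.Cruxes.FiniteRankMirrorDefectPeeling

/-! ## §3 The defect as a mirror covariance, and its peeling at one coupling on one torus -/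

section Peel

variable (G : Type) [Group G] [TopologicalSpace G] [IsTopologicalGroup G] [CompactSpace G]
  [MeasurableSpace G] [BorelSpace G] (r : LatticeRep G)

omit [Group G] [TopologicalSpace G] [IsTopologicalGroup G] [CompactSpace G] [MeasurableSpace G] [BorelSpace G] in
/-- Differences of cylinder observables are cylinder observables on the union of the supports. [folklore] -/
theorem isCylinder_sub {F H : LGConfig 4 G → ℝ} {S S' : Finset (Literature.MathematicalPhysics.QuantumLattice.ZdEdge 4)}
    (hF : IsCylinder F S) (hH : IsCylinder H S') : IsCylinder (fun U => F U - H U) (S ∪ S') := by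
  classical
  intro U V h
  show F U - H U = F V - H V
  rw [hF fun e he => h e (by simp [Finset.mem_coe.1 he]), hH fun e he => h e (by simp [Finset.mem_coe.1 he])]

omit [Group G] [TopologicalSpace G] [IsTopologicalGroup G] [CompactSpace G] [MeasurableSpace G] [BorelSpace G] in
/-- A cube of physical size `(|c j| + b + 3)·s ≤ Λ₅` sits, on every torus `Λ₅ ≤ s·L`, in the coordinate window of the
peeling lemmas (`−L + 2 ≤ c j`, `c j + b + 3 ≤ L`), and its sites lie in `box 4 L`. [folklore] -/
theorem window_of_geom {s Λ₅ : ℝ} (hs : 0 < s) {c : Fin 4 → ℤ} {b L : ℕ}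
    (hsize : ∀ j : Fin 4, (|((c j : ℤ) : ℝ)| + (b : ℝ) + 3) * s ≤ Λ₅) (hL : Λ₅ ≤ s * L) :
    (∀ j : Fin 4, -(L : ℤ) + 2 ≤ c j ∧ c j + (b : ℤ) + 3 ≤ (L : ℤ)) ∧ cubeSites c b ⊆ box 4 L := by
  have hfitZ : ∀ j : Fin 4, |c j| + (b : ℤ) + 3 ≤ (L : ℤ) := fun j => by
    have h : |((c j : ℤ) : ℝ)| + (b : ℝ) + 3 ≤ (L : ℝ) := le_of_mul_le_mul_right (by nlinarith [hsize j, hL]) hs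
    rw [Int.cast_abs.symm] at h
    exact_mod_cast h
  have hwin : ∀ j : Fin 4, -(L : ℤ) + 2 ≤ c j ∧ c j + (b : ℤ) + 3 ≤ (L : ℤ) := fun j => by
    have h := hfitZ j
    have h1 := le_abs_self (c j)
    have h2 := neg_abs_le (c j)
    constructor <;> linarith
  refine ⟨hwin, fun y hy => ?_⟩
  rw [mem_box]
  intro j
  have h := (mem_cubeSites_iff _ _ _).1 hy j
  have h' := hwin j
  constructor <;> linarith [h.1, h.2, h'.1, h'.2]

/-- **The chirality defect is a mirror covariance.**  On the torus `2L+1`, at spacing `s`, for a test function whose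
lattice support `{y : v(s·y) ≠ 0}` lies in a cube `Q ⊆ box 4 L`:
`Q2_{β,L,s}(θv, v) − (E_T[(Ṽ_box∘Θ₀)·Ṽ_box] − E_T[Ṽ_box]²) = E_T[((Wᴿ − Ṽ)∘Θ₀)·Ṽ] − E_T[Wᴿ − Ṽ]·E_T[Ṽ]`, where `Ṽ_box`
(resp. `Ṽ`) is the smearing `∑ v(s·y) dens_y` over the box (resp. the cube) and `Wᴿ` the reflected-species smearing
(`MarkovMirror.Q2_thetaTest_eq_torusCov_reflSmear` + reflection invariance of Wilson's torus measure). [folklore] -/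
theorem defect_eq_mirrorCov (β : ℝ) (L : ℕ) (s : ℝ) (v : 𝓢(EuclideanSpace ℝ (Fin 4), ℝ))
    (c : Fin 4 → ℤ) (b : ℕ) (hsub : cubeSites c b ⊆ box 4 L)
    (hsupp : ∀ y : Fin 4 → ℤ, v (s • siteToE y) ≠ 0 → y ∈ cubeSites c b) :
    Q2 G r β L s (thetaTest 4 v) v -
        (torusE G r β L (fun V => (∑ y ∈ box 4 L, v (s • siteToE y) * dens G r y (cfgReflect V)) *
            ∑ y ∈ box 4 L, v (s • siteToE y) * dens G r y V) -
          torusE G r β L (fun V => ∑ y ∈ box 4 L, v (s • siteToE y) * dens G r y V) ^ 2) =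
      torusE G r β L (fun U =>
          ((∑ x ∈ cubeSites c b, v (s • siteToE x) *
              ∑ q : {q : Fin 4 × Fin 4 // q.1 < q.2},
                plane G r q.1 (if q.1.1 = 0 then x - Pi.single 0 1 else x) (cfgReflect U)) -
            ∑ y ∈ cubeSites c b, v (s • siteToE y) * dens G r y (cfgReflect U)) *
          ∑ y ∈ cubeSites c b, v (s • siteToE y) * dens G r y U) -
        torusE G r β L (fun U =>
          (∑ x ∈ cubeSites c b, v (s • siteToE x) *
              ∑ q : {q : Fin 4 × Fin 4 // q.1 < q.2}, plane G r q.1 (if q.1.1 = 0 then x - Pi.single 0 1 else x) U) -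
            ∑ y ∈ cubeSites c b, v (s • siteToE y) * dens G r y U) *
          torusE G r β L (fun U => ∑ y ∈ cubeSites c b, v (s • siteToE y) * dens G r y U) := by
  -- notation-free abbreviations
  set W : LGConfig 4 G → ℝ := fun U => ∑ x ∈ cubeSites c b, v (s • siteToE x) *
    ∑ q : {q : Fin 4 × Fin 4 // q.1 < q.2}, plane G r q.1 (if q.1.1 = 0 then x - Pi.single 0 1 else x) U with hW
  set Vt : LGConfig 4 G → ℝ := fun U => ∑ y ∈ cubeSites c b, v (s • siteToE y) * dens G r y U with hVt
  have hWc : Continuous W := NT.MarkovMirror.continuous_reflSmear G r (cubeSites c b) _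
  have hVc : Continuous Vt := NT.MarkovMirror.continuous_cubeSmear G r c b _
  have hΘ : Continuous (cfgReflect (G := G)) := NT.MarkovMirror.continuous_cfgReflect
  -- the box smearing is the cube smearing
  have hbox : ∀ U : LGConfig 4 G, ∑ y ∈ box 4 L, v (s • siteToE y) * dens G r y U = Vt U := by
    intro U
    rw [hVt]
    exact (Finset.sum_subset hsub fun y _ hy => by
      have : v (s • siteToE y) = 0 := by by_contra h; exact hy (hsupp y h)
      rw [this, zero_mul]).symm
  have hQ2 := NT.MarkovMirror.Q2_thetaTest_eq_torusCov_reflSmear G r β L s v c b hsub hsupp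
  have e1 : (fun V => (∑ y ∈ box 4 L, v (s • siteToE y) * dens G r y (cfgReflect V)) *
      ∑ y ∈ box 4 L, v (s • siteToE y) * dens G r y V) = fun V => Vt (cfgReflect V) * Vt V := by
    funext V; rw [hbox, hbox]
  have e2 : (fun V => ∑ y ∈ box 4 L, v (s • siteToE y) * dens G r y V) = Vt := by
    funext V; rw [hbox]
  rw [hQ2, e1, e2]
  change torusE G r β L (fun V => W (cfgReflect V) * Vt V) - torusE G r β L (fun V => W (cfgReflect V)) * torusE G r β L Vt -
      (torusE G r β L (fun V => Vt (cfgReflect V) * Vt V) - torusE G r β L Vt ^ 2) =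
    torusE G r β L (fun U => (W (cfgReflect U) - Vt (cfgReflect U)) * Vt U) -
      torusE G r β L (fun U => W U - Vt U) * torusE G r β L Vt
  have hWΘ : torusE G r β L (fun V => W (cfgReflect V)) = torusE G r β L W :=
    NT.ConjugateResponse.torusE_comp_cfgReflect G r β L W
  have hsub1 : torusE G r β L (fun U => (W (cfgReflect U) - Vt (cfgReflect U)) * Vt U) =
      torusE G r β L (fun V => W (cfgReflect V) * Vt V) - torusE G r β L (fun V => Vt (cfgReflect V) * Vt V) := by
    have e : (fun U => (W (cfgReflect U) - Vt (cfgReflect U)) * Vt U) =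
        fun U => W (cfgReflect U) * Vt U - Vt (cfgReflect U) * Vt U := by funext U; ring
    rw [e]
    exact NT.CumulantPolarisation.torusE_sub G r β L ((hWc.comp hΘ).mul hVc) ((hVc.comp hΘ).mul hVc)
  have hsub2 : torusE G r β L (fun U => W U - Vt U) = torusE G r β L W - torusE G r β L Vt :=
    NT.CumulantPolarisation.torusE_sub G r β L hWc hVc
  rw [hsub1, hsub2, hWΘ]
  ring

/-- **Peeling the chirality defect.**  A cube `Q = (c, b)` at times `≥ 1` in the coordinate window of the odd torus
`2L+1`, carrying the lattice support of `v(s·)` at depth `≥ 2`.  Then for all reference values `p₁, p₂`: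
`|Q2(θv, v) − MF_box(v)| ≤ 2·‖kerE_Q(Wᴿ) − kerE_Q(Ṽ) − p₁‖_{L²(μ_T)}·‖kerE_Q(Ṽ) − p₂‖_{L²(μ_T)}`
(`defect_eq_mirrorCov` + `FiniteRankMirrorPeeling.mirror_peel` with `F₁ = Wᴿ − Ṽ`, `F₂ = Ṽ`; no reflection
positivity). [folklore] -/
theorem abs_defect_le_peel (β : ℝ) (L : ℕ) (s : ℝ) (v : 𝓢(EuclideanSpace ℝ (Fin 4), ℝ))
    (c : Fin 4 → ℤ) (b : ℕ) (hc0 : 1 ≤ c 0) (hc : ∀ j, -(L : ℤ) + 2 ≤ c j ∧ c j + (b : ℤ) + 3 ≤ (L : ℤ))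
    (hsub : cubeSites c b ⊆ box 4 L)
    (hsupp : ∀ y : Fin 4 → ℤ, v (s • siteToE y) ≠ 0 → y ∈ cubeSites c b ∧ 2 ≤ depth c b y) (p₁ p₂ : ℝ) :
    |Q2 G r β L s (thetaTest 4 v) v -
        (torusE G r β L (fun V => (∑ y ∈ box 4 L, v (s • siteToE y) * dens G r y (cfgReflect V)) *
            ∑ y ∈ box 4 L, v (s • siteToE y) * dens G r y V) -
          torusE G r β L (fun V => ∑ y ∈ box 4 L, v (s • siteToE y) * dens G r y V) ^ 2)| ≤
      2 * Real.sqrt (torusE G r β L (fun U =>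
          (kerE G r β c b U (fun V => ∑ x ∈ cubeSites c b, v (s • siteToE x) *
              ∑ q : {q : Fin 4 × Fin 4 // q.1 < q.2}, plane G r q.1 (if q.1.1 = 0 then x - Pi.single 0 1 else x) V) -
            kerE G r β c b U (fun V => ∑ y ∈ cubeSites c b, v (s • siteToE y) * dens G r y V) - p₁) ^ 2)) *
        Real.sqrt (torusE G r β L (fun U =>
          (kerE G r β c b U (fun V => ∑ y ∈ cubeSites c b, v (s • siteToE y) * dens G r y V) - p₂) ^ 2)) := by
  set W : LGConfig 4 G → ℝ := fun U => ∑ x ∈ cubeSites c b, v (s • siteToE x) *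
    ∑ q : {q : Fin 4 × Fin 4 // q.1 < q.2}, plane G r q.1 (if q.1.1 = 0 then x - Pi.single 0 1 else x) U with hW
  set Vt : LGConfig 4 G → ℝ := fun U => ∑ y ∈ cubeSites c b, v (s • siteToE y) * dens G r y U with hVt
  rw [defect_eq_mirrorCov G r β L s v c b hsub fun y hy => (hsupp y hy).1]
  change |torusE G r β L (fun U => (W (cfgReflect U) - Vt (cfgReflect U)) * Vt U) -
      torusE G r β L (fun U => W U - Vt U) * torusE G r β L Vt| ≤
    2 * Real.sqrt (torusE G r β L (fun U => (kerE G r β c b U W - kerE G r β c b U Vt - p₁) ^ 2)) *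
      Real.sqrt (torusE G r β L (fun U => (kerE G r β c b U Vt - p₂) ^ 2))
  -- regularity of `Wᴿ`, `Ṽ` and `D = Wᴿ − Ṽ`
  have hWc : Continuous W := NT.MarkovMirror.continuous_reflSmear G r (cubeSites c b) _
  have hVc : Continuous Vt := NT.MarkovMirror.continuous_cubeSmear G r c b _
  obtain ⟨MW, hMW⟩ := NT.MarkovMirror.exists_abs_reflSmear_le G r (cubeSites c b) (fun x => v (s • siteToE x))
  obtain ⟨MV, hMV⟩ := NT.MarkovMirror.exists_abs_cubeSmear_le G r c b (fun y => v (s • siteToE y))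
  obtain ⟨SW, hWS, hSW⟩ := NT.MarkovMirror.exists_isCylinder_reflSmear G r c b (fun x => v (s • siteToE x))
    (fun x _ hx => (hsupp x hx).2)
  obtain ⟨SV, hVS, hSV⟩ := NT.MarkovMirror.exists_isCylinder_cubeSmear G r c b (fun y => v (s • siteToE y))
  have hDc : Continuous fun U => W U - Vt U := hWc.sub hVc
  have hDM : ∀ U, |(fun U => W U - Vt U) U| ≤ MW + MV := fun U =>
    (abs_sub _ _).trans (add_le_add (hMW U) (hMV U))
  have hDS : IsCylinder (fun U => W U - Vt U) (SW ∪ SV) := isCylinder_sub G hWS hVS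
  have hDwin : ∀ e ∈ SW ∪ SV, ∀ j, c j ≤ e.1 j ∧ e.1 j ≤ c j + b := by
    intro e he j
    rcases Finset.mem_union.1 he with h | h
    · exact hSW e h j
    · exact hSV e h j
  have hpeel := FiniteRankMirrorPeeling.mirror_peel G r β L c b hc0 hc hDc hVc hDM hMV hDS hVS hDwin hSV p₁ p₂
  have hk : (fun U => (kerE G r β c b U (fun U => W U - Vt U) - p₁) ^ 2) =
      fun U => (kerE G r β c b U W - kerE G r β c b U Vt - p₁) ^ 2 := by
    funext U; rw [NT.MarkovMirror.kerE_sub' G r β c b U hWc hVc]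
  rw [hk] at hpeel
  exact hpeel

end Peel

/-! ## §4 The second peeling factor along a unit map, and the glue item -/

section Assembly

variable (G : Type) [Group G] [TopologicalSpace G] [IsTopologicalGroup G] [CompactSpace G]
  [MeasurableSpace G] [BorelSpace G] (r : LatticeRep G)

/-- **The smearing factor is `O(1)` along a unit map under (RM₁).**  Under the hypotheses of
`MarkovMirror.typicalLaw_of_responseMoments` (unit `a → 0⁺`, (RM₁) at `a' = a`, a positive-time cube family of
physical size `≤ Λ₅`, femto `b_β·aβ ≤ ℓ₁`, carrying the thickened support of `v(aβ·)` at physical depth `≥ κ`) plus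
`aβ ≤ 1` and compact support of `v`: there is `K_V ≥ 0` with `E_T[(kerE_{Q_β}(Ṽ) − p_V β)²] ≤ K_V²` eventually in `β` on
every torus `2Λ₅ ≤ aβ·L`, `p_V β = ∑_y v(aβ·y) ∑_q p q β` (`typicalLaw_of_responseMoments` ⊕
`smear_response_sq_le_uniform`). [folklore] -/
theorem smear_l2_le_of_responseMoments (a : ℝ → ℝ) (ha₀ : ∀ β, 0 < a β) (ha : Tendsto a atTop (𝓝 0))
    (v : 𝓢(EuclideanSpace ℝ (Fin 4), ℝ)) (hvK : HasCompactSupport (v : EuclideanSpace ℝ (Fin 4) → ℝ))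
    {κ C₁ B β₁ ℓ₁ β₅ Λ₅ : ℝ} (hκ : 0 < κ) (hC₁ : 0 < C₁) (hℓ₁ : 0 < ℓ₁)
    (p : Fin 4 × Fin 4 → ℝ → ℝ) (c : ℝ → (Fin 4 → ℤ)) (b : ℝ → ℕ)
    (hone : ∀ β, β₅ ≤ β → a β ≤ 1)
    (hgeom : ∀ β, β₅ ≤ β → 1 ≤ c β 0 ∧ ∀ j : Fin 4, (|((c β j : ℤ) : ℝ)| + (b β : ℝ) + 3) * a β ≤ Λ₅)
    (hfemto : ∀ β, β₅ ≤ β → (b β : ℝ) * a β ≤ ℓ₁)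
    (hthick : ∀ β, β₅ ≤ β → ∀ x : Fin 4 → ℤ,
      (v (a β • siteToE x) ≠ 0 ∨ v (a β • siteToE (x + Pi.single 0 1)) ≠ 0) →
        x ∈ cubeSites (c β) (b β) ∧ κ / a β ≤ (depth (c β) (b β) x : ℝ))
    (hRM : ∀ β : ℝ, β₁ ≤ β → ∀ (L : ℕ) (q : Fin 4 × Fin 4) (x : Fin 4 → ℤ) (R : ℕ), q.1 < q.2 → 1 ≤ R →
      (R : ℝ) * a β ≤ ℓ₁ → 4 * R + 8 ≤ L →
      torusE G r β L (fun U => Real.exp ((R : ℝ) ^ 4 / C₁ *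
        |kerE G r β (fun k => x k - (R + 1)) (2 * R + 3) U (plane G r q x) - p q β|)) ≤ Real.exp B) :
    ∃ (KV β₆ : ℝ), 0 ≤ KV ∧ ∀ β, β₆ ≤ β → ∀ L : ℕ, 2 * Λ₅ ≤ a β * L →
      torusE G r β L (fun U => (kerE G r β (c β) (b β) U
          (fun V => ∑ y ∈ cubeSites (c β) (b β), v (a β • siteToE y) * dens G r y V) -
        ∑ y ∈ cubeSites (c β) (b β), v (a β • siteToE y) * ∑ q : {q : Fin 4 × Fin 4 // q.1 < q.2}, p q.1 β) ^ 2) ≤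
        KV ^ 2 := by
  obtain ⟨β₆, hlaw⟩ := NT.MarkovMirror.typicalLaw_of_responseMoments G r a a ha₀ ha v hκ hC₁ hℓ₁ p c b hgeom hfemto
    hthick hRM
  obtain ⟨M, hM1, hvM⟩ := exists_radius hvK
  obtain ⟨K₀, hK₀⟩ := v.continuous.bounded_above_of_compact_support hvK
  have hvK' : ∀ z, |v z| ≤ max K₀ 0 := fun z => by
    have := hK₀ z; rw [Real.norm_eq_abs] at this; exact this.trans (le_max_left _ _)
  have hC' : 0 ≤ 4 ^ 4 * C₁ * (1 + Real.exp B) := by positivity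
  refine ⟨6 * 7 ^ 4 * (max K₀ 0) * (4 ^ 4 * C₁ * (1 + Real.exp B)) * M ^ 4 / κ ^ 4, max β₅ β₆, by positivity,
    fun β hβ L hL => ?_⟩
  have hβ₅ : β₅ ≤ β := le_trans (le_max_left _ _) hβ
  have hβ₆ : β₆ ≤ β := le_trans (le_max_right _ _) hβ
  exact smear_response_sq_le_uniform G r β (c β) (b β) L (ha₀ β) ((hone β hβ₅).trans hM1) hM1 hκ hC'
    (le_max_right _ _) v hvM hvK' (hthick β hβ₅) (fun q => p q.1 β) (fun q x hx hxv => hlaw β hβ₆ L hL q x hx hxv)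

/-- Scalar endgame: `2·√A·√B ≤ η` when `A ≤ (η/(2K+2))²`, `B ≤ K²`, `K ≥ 0`, `η > 0`. [folklore] -/
theorem two_mul_sqrt_mul_sqrt_le {A B K η : ℝ} (hK : 0 ≤ K) (hη : 0 < η) (hA : A ≤ (η / (2 * K + 2)) ^ 2)
    (hB : B ≤ K ^ 2) : 2 * Real.sqrt A * Real.sqrt B ≤ η := by
  have h1 : Real.sqrt A ≤ η / (2 * K + 2) := by
    rw [← Real.sqrt_sq (show 0 ≤ η / (2 * K + 2) by positivity)]
    exact Real.sqrt_le_sqrt hA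
  have h2 : Real.sqrt B ≤ K := by
    rw [← Real.sqrt_sq hK]; exact Real.sqrt_le_sqrt hB
  have h3 : 2 * Real.sqrt A * Real.sqrt B ≤ 2 * (η / (2 * K + 2)) * K :=
    mul_le_mul (mul_le_mul_of_nonneg_left h1 (by norm_num)) h2 (Real.sqrt_nonneg _) (by positivity)
  refine h3.trans ?_
  rw [show 2 * (η / (2 * K + 2)) * K = η * (2 * K / (2 * K + 2)) by ring]
  have h4 : 2 * K / (2 * K + 2) ≤ 1 := by
    rw [div_le_one (by positivity)]; linarith
  nlinarith

end Assembly

end Summit.QuantumFields.YangMills.Cruxes.FiniteRankMirrorDefectPeeling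

/-- **Defect peeling glue** — the glue item `DefectPeelingGlue` of route `FiniteRankMirror` (stmt-QuantumFields-23849,
LINE g9-1b «Markov peeling» of ideator seat ym-idea-8; shared with route `StaticSourceWitness`):
`FemtoResponseLaw → MirrorPeeling → MirrorDefectVanishes`.  The bare mirror floor pinning the unit is the `J = 1` menu
of `FemtoResponseMoments`; with `ℓ₃ := ℓ₁/8`, for `v` supported in `{y₀ > 0} ∩ B(0, ℓ₃)` the positive-time femto cube
family of `exists_posTimeCubeFamily` carries `v(aβ·)`; the defect is peeled (`abs_defect_le_peel`), the first factor is
eventually `≤ √η₁` by `MarkovMirror.rblΔ_l2_eventually_of_responseMoments`, the second is `≤ K_V`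
(`smear_l2_le_of_responseMoments`), and `η₁ := (η/(2K_V + 2))²`.  (The hypothesis `MirrorPeeling` is the item form of
`FiniteRankMirrorPeeling.mirror_peel`, which is used directly.)  No NT / summit statement is proved. [folklore] -/
theorem Summit.QuantumFields.YangMills.Theorems.finiteRankMirror_defectPeelingGlue :
    Summit.QuantumFields.YangMills.Theses.FiniteRankMirror.DefectPeelingGlue := by
  intro hRL _hMP G _ _ _ _ hG
  letI : MeasurableSpace G := borel G
  haveI : BorelSpace G := ⟨rfl⟩
  intro r a ha₀ ha hpin
  obtain ⟨v₀, ε₀, β₀, Λ₀, hv₀, hε₀, hfloor₀⟩ := hpin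
  -- (RM₁) at the pinned unit, from the `J = 1` menu
  obtain ⟨p, C₁, B, β₁, ℓ₁, hC₁, hℓ₁, hRM⟩ := hRL G hG r a ha₀ ha
    ⟨1, fun _ => v₀, ε₀, β₀, Λ₀, fun _ => hv₀, hε₀, fun β hβ L hL => by
      rw [Fin.sum_univ_one]; exact hfloor₀ β hβ L hL⟩
  refine ⟨ℓ₁ / 8, by positivity, fun v hv0 hvB η hη => ?_⟩
  -- compact support, time floor
  have hvK : HasCompactSupport (v : EuclideanSpace ℝ (Fin 4) → ℝ) :=
    HasCompactSupport.of_support_subset_isCompact (isCompact_closedBall 0 (ℓ₁ / 8))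
      ((subset_tsupport _).trans hvB)
  obtain ⟨δ₀, M₀, hδ₀, -, hvT₀⟩ :=
    Summit.QuantumFields.YangMills.Cruxes.UVSeamRec.UnitTransfer.exists_time_floor_and_radius hvK hv0
  have hvBall : ∀ z, v z ≠ 0 → ‖z‖ ≤ ℓ₁ / 8 := fun z hz => by
    have := hvB (subset_tsupport _ hz)
    rwa [Metric.mem_closedBall, dist_zero_right] at this
  set δ : ℝ := min δ₀ (ℓ₁ / 8) with hδ
  have hδpos : 0 < δ := lt_min hδ₀ (by positivity)
  have hδℓ : δ ≤ ℓ₁ / 8 := min_le_right _ _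
  have hvT : ∀ z, v z ≠ 0 → δ ≤ z 0 := fun z hz => (min_le_left _ _).trans (hvT₀ z hz).1
  -- the cube family
  obtain ⟨β₅, c, b, hadm, hgeom, hfem, hsupp, hthick⟩ :=
    Summit.QuantumFields.YangMills.Cruxes.FiniteRankMirrorDefectPeeling.exists_posTimeCubeFamily a ha₀ ha v
      (by positivity : (0 : ℝ) < ℓ₁ / 8) hδpos hvBall hvT
  have hκ : (0 : ℝ) < δ / 2 := by positivity
  have hfemto : ∀ β, β₅ ≤ β → (b β : ℝ) * a β ≤ ℓ₁ := fun β hβ => by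
    have h1 := hfem β hβ
    have h2 := (hadm β hβ).2
    nlinarith
  -- the two peeling factors along the unit map
  obtain ⟨KV, β₆, hKV, hV⟩ :=
    Summit.QuantumFields.YangMills.Cruxes.FiniteRankMirrorDefectPeeling.smear_l2_le_of_responseMoments G r a ha₀ ha v
      hvK hκ hC₁ hℓ₁ p c b (fun β hβ => (hadm β hβ).1) hgeom hfemto hthick hRM
  have hη₁ : 0 < (η / (2 * KV + 2)) ^ 2 := by positivity
  obtain ⟨β₇, hΔ⟩ := Summit.QuantumFields.YangMills.Cruxes.NT.MarkovMirror.rblΔ_l2_eventually_of_responseMoments G r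
    a a ha₀ ha v hvK hκ hC₁ hℓ₁ p c b hgeom hfemto hsupp hthick hRM hη₁
  refine ⟨max β₅ (max β₆ β₇), 2 * (3 * (ℓ₁ / 8 + δ / 2) + 14), fun β hβ L hL => ?_⟩
  have hβ₅ : β₅ ≤ β := le_trans (le_max_left _ _) hβ
  have hβ₆ : β₆ ≤ β := le_trans (le_trans (le_max_left _ _) (le_max_right _ _)) hβ
  have hβ₇ : β₇ ≤ β := le_trans (le_trans (le_max_right _ _) (le_max_right _ _)) hβ
  obtain ⟨hc0, hsize⟩ := hgeom β hβ₅
  have hL1 : 3 * (ℓ₁ / 8 + δ / 2) + 14 ≤ a β * L := by nlinarith [hL]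
  obtain ⟨hwin, hsub⟩ :=
    Summit.QuantumFields.YangMills.Cruxes.FiniteRankMirrorDefectPeeling.window_of_geom (ha₀ β) hsize hL1
  have hpeel := Summit.QuantumFields.YangMills.Cruxes.FiniteRankMirrorDefectPeeling.abs_defect_le_peel G r β L (a β) v
    (c β) (b β) hc0 hwin hsub (hsupp β hβ₅)
    (∑ x ∈ cubeSites (c β) (b β), (v (a β • siteToE (x + Pi.single 0 1)) - v (a β • siteToE x)) *
      ∑ q : {q : Fin 4 × Fin 4 // q.1 < q.2}, (if q.1.1 = 0 then p q.1 β else 0))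
    (∑ y ∈ cubeSites (c β) (b β), v (a β • siteToE y) * ∑ q : {q : Fin 4 × Fin 4 // q.1 < q.2}, p q.1 β)
  exact hpeel.trans (Summit.QuantumFields.YangMills.Cruxes.FiniteRankMirrorDefectPeeling.two_mul_sqrt_mul_sqrt_le hKV hη
    (hΔ β hβ₇ L hL) (hV β hβ₆ L hL))

end
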